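import Literature.Analysis.FluidPDE.PressureEquationSlicing
import HarnessLib

/-!
# Time slices of the bare pressure identity `∫∫ (D²θ(u, u) + p Δθ) = 0`

Analysis/FluidPDE support file (all results proved, no definitions, no named facts) for the
discharge of the named fact `Literature.Analysis.FluidPDE.RRS2016.lemma15_12`
(`CKNLocalRegularityRRS.lean`; Robinson–Rodrigo–Sadowski 2016, Lemma 15.12, the local pressure
estimate, stated slice-wise for a.e. time). The accepted `PressureEquationSlicing.lean` slices
the distributional pressure equation of a **distributional Navier–Stokes solution**
(`IsDistributionalNSSolutionOn.ae_slice_pressure_identity`,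
`IsDistributionalNSSolutionOn.ae_forall_slice_pressure_identity`: for a.e. `t` the slice
`(u(t), p(t))` satisfies `∫ p(t) Δψ = -∫ D²ψ(u(t), u(t))` for all `ψ ∈ C_c^∞(Ω)`); the
Navier–Stokes system enters those proofs only through (i) the local integrability of `u`,
`|u|²`, `p` and (ii) the space–time identity `∫∫ (D²θ(u, u) + p Δθ) = 0` for all
`θ ∈ C_c^∞((a, b) × Ω)` (`integral_hessian_add_pressure_laplacian_eq_zero`). Lemma 15.12 is a
statement about pairs `(u, p)` which are assumed to satisfy exactly (i) and (ii) — the pressure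
equation `-Δp = ∂ᵢ∂ⱼ(uᵢuⱼ)` in `𝒟'(Q_ρ)` of a suitable pair, Def. 15.2 (ii) — and nothing else, so
this file records the same three statements with (i) and (ii) as the hypotheses (proofs
verbatim, `hns` replaced by the three integrability classes and the identity):

* `integrableOn_hessian_add_pressure_mul_of_locallyIntegrableOn`;
* `ae_slice_pressure_identity_of_identity` — for each `ψ ∈ C_c^∞(Ω)`,
  `∫ (D²ψ(u(t), u(t)) + p(t) Δψ) = 0` for a.e. `t ∈ (a, b)`;
* `ae_forall_slice_pressure_identity_of_identity` — for a.e. `t ∈ (a, b)` at which the slices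
  are locally integrable, `∫ p(t) Δψ = -∫ D²ψ(u(t), u(t))` for **all** `ψ ∈ C_c^∞(Ω)`.

## References

* J. C. Robinson, J. L. Rodrigo, W. Sadowski, *The three-dimensional Navier–Stokes equations*,
  CUP (2016): Def. 15.2 (ii) and Lemma 15.12 (pp. 212, 232). [RobinsonRodrigoSadowski2016]
* G. Seregin, *Lecture Notes on Regularity Theory for the Navier–Stokes Equations*, World
  Scientific 2014, §6.3 (proof of Prop. 3.10: the slice-wise pressure equation "for all
  possible values of `s`"). [Seregin2014]
-/

noncomputable section

open MeasureTheory Set Function Filter Topology TopologicalSpace Metric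
open scoped NNReal ENNReal InnerProductSpace RealInnerProductSpace ContDiff Laplacian

namespace Literature.Analysis.FluidPDE

section SliceIdentity

variable {E : Type*} [NormedAddCommGroup E] [InnerProductSpace ℝ E] [FiniteDimensional ℝ E]
  [MeasurableSpace E] [BorelSpace E]

variable {Q : Opens (ℝ × E)} {u : ℝ → E → E} {p : ℝ → E → ℝ}

-- nested operator types
set_option maxSynthPendingDepth 3 in
/-- **Integrability of the tested pressure-equation integrand.** For `u`, `|u|²`, `p` locally
integrable on an open `Q ⊆ ℝ × E`, a continuous operator field `Θ` and a continuous scalar `c` on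
space–time which vanish at the points of a measurable set `S` outside a compact `C ⊆ Q`, the
integrand `Θ(u, u) + p c` is integrable on `S` (verbatim
`IsDistributionalNSSolutionOn.integrableOn_hessian_add_pressure_mul`). [folklore] -/
theorem integrableOn_hessian_add_pressure_mul_of_locallyIntegrableOn
    (hu : LocallyIntegrableOn (uncurry u) (Q : Set (ℝ × E)) volume)
    (hu2 : LocallyIntegrableOn (fun z => ‖uncurry u z‖ ^ 2) (Q : Set (ℝ × E)) volume)
    (hp : LocallyIntegrableOn (uncurry p) (Q : Set (ℝ × E)) volume)
    {Θ : ℝ × E → E →L[ℝ] E →L[ℝ] ℝ} {c : ℝ × E → ℝ} (hΘ : Continuous Θ) (hc : Continuous c)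
    {C : Set (ℝ × E)} (hC : IsCompact C) (hCQ : C ⊆ (Q : Set (ℝ × E)))
    {S : Set (ℝ × E)} (hS : MeasurableSet S)
    (hΘ0 : ∀ z ∈ S, z ∉ C → Θ z = 0) (hc0 : ∀ z ∈ S, z ∉ C → c z = 0) :
    IntegrableOn (fun z : ℝ × E => Θ z (u z.1 z.2) (u z.1 z.2) + p z.1 z.2 * c z) S volume := by
  have huC : IntegrableOn (uncurry u) C volume := hu.integrableOn_compact_subset hCQ hC
  have hu2C : IntegrableOn (fun z => ‖uncurry u z‖ ^ 2) C volume :=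
    hu2.integrableOn_compact_subset hCQ hC
  have hpC : IntegrableOn (uncurry p) C volume := hp.integrableOn_compact_subset hCQ hC
  obtain ⟨M, hM⟩ := hC.exists_bound_of_continuousOn hΘ.continuousOn
  have h1 : IntegrableOn (fun z : ℝ × E => Θ z (u z.1 z.2) (u z.1 z.2)) C volume := by
    refine Integrable.mono' (hu2C.const_mul M)
      (aestronglyMeasurable_bilin_apply_self hΘ.aestronglyMeasurable huC.aestronglyMeasurable) ?_
    filter_upwards [ae_restrict_mem hC.measurableSet] with z hz
    calc ‖Θ z (u z.1 z.2) (u z.1 z.2)‖ ≤ ‖Θ z‖ * ‖u z.1 z.2‖ * ‖u z.1 z.2‖ := (Θ z).le_opNorm₂ _ _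
      _ = ‖Θ z‖ * ‖uncurry u z‖ ^ 2 := by simp only [uncurry]; ring
      _ ≤ M * ‖uncurry u z‖ ^ 2 := mul_le_mul_of_nonneg_right (hM z hz) (sq_nonneg _)
  have h2 : IntegrableOn (fun z : ℝ × E => p z.1 z.2 * c z) C volume :=
    hpC.mul_continuousOn hc.continuousOn hC
  refine (h1.add h2).of_forall_sdiff_eq_zero hS fun z hz => ?_
  simp [hΘ0 z hz.1 hz.2, hc0 z hz.1 hz.2]

variable {a b : ℝ} {Ω : Opens E}

-- nested operator types
set_option maxSynthPendingDepth 3 in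
/-- **The slice identity for one test function (bare pressure identity).** Let `u`, `|u|²`,
`p` be locally integrable on the product region `(a, b) × Ω` and let
`∫∫ (D²θ(u, u) + p Δθ) = 0` hold for all `θ ∈ C_c^∞((a, b) × Ω)` (for distributional
Navier–Stokes solutions this is `integral_hessian_add_pressure_laplacian_eq_zero`; for the
suitable pairs of Robinson–Rodrigo–Sadowski 2016, Def. 15.2 (ii), it is the pressure equation
itself). Then for every `ψ ∈ C_c^∞(Ω)`, `∫ (D²ψ(u(t), u(t)) + p(t) Δψ) dx = 0` for a.e.
`t ∈ (a, b)`: test with `θ = η(t) ψ(x)`, `η ∈ C_c^∞((a, b))`, and apply the fundamental lemma of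
the calculus of variations in `t` (verbatim `IsDistributionalNSSolutionOn.ae_slice_pressure_identity`).
[cite: Seregin2014, §6.3 (proof of Prop. 3.10)] -/
theorem ae_slice_pressure_identity_of_identity
    (hu : LocallyIntegrableOn (uncurry u) (Ioo a b ×ˢ (Ω : Set E)) volume)
    (hu2 : LocallyIntegrableOn (fun z => ‖uncurry u z‖ ^ 2) (Ioo a b ×ˢ (Ω : Set E)) volume)
    (hp : LocallyIntegrableOn (uncurry p) (Ioo a b ×ˢ (Ω : Set E)) volume)
    (hid : ∀ θ : ℝ → E → ℝ,
      IsSpaceTimeTestOn (⟨Ioo a b ×ˢ (Ω : Set E), isOpen_Ioo.prod Ω.isOpen⟩ : Opens (ℝ × E)) θ →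
      ∫ z in Ioo a b ×ˢ (Ω : Set E),
        (fderiv ℝ (fderiv ℝ (θ z.1)) z.2 (u z.1 z.2) (u z.1 z.2) + p z.1 z.2 * Δ (θ z.1) z.2) = 0)
    {ψ : E → ℝ} (hψ : FunctionSpaces.IsTestFunctionOn Ω ψ) :
    ∀ᵐ t ∂(volume.restrict (Ioo a b)),
      ∫ x, (fderiv ℝ (fderiv ℝ ψ) x (u t x) (u t x) + p t x * Δ ψ x) = 0 := by
  set Q : Opens (ℝ × E) := ⟨Ioo a b ×ˢ (Ω : Set E), isOpen_Ioo.prod Ω.isOpen⟩ with hQ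
  set g : ℝ → ℝ := fun t => ∫ x, (fderiv ℝ (fderiv ℝ ψ) x (u t x) (u t x) + p t x * Δ ψ x)
    with hg
  have hψ2 : ContDiff ℝ 2 ψ := contDiff_infty.1 hψ.contDiff 2
  have hHc : Continuous (fderiv ℝ (fderiv ℝ ψ)) :=
    (hψ2.fderiv_right (m := 1) (by norm_num)).continuous_fderiv one_ne_zero
  have hΔc : Continuous (Δ ψ) := FluidPDE.continuous_laplacian hψ2
  have hH0 : ∀ x ∉ tsupport ψ, fderiv ℝ (fderiv ℝ ψ) x = 0 := fun x hx =>
    fderiv_fderiv_eq_zero_of_notMem_tsupport hx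
  have hΔ0 : ∀ x ∉ tsupport ψ, Δ ψ x = 0 := fun x hx =>
    FluidPDE.laplacian_eq_zero_of_notMem_tsupport hx
  -- local integrability of `g` on `(a, b)`: Fubini on `J × E`
  have hloc : LocallyIntegrableOn g (Ioo a b) volume := by
    refine (locallyIntegrableOn_iff isOpen_Ioo.isLocallyClosed).2 fun J hJ hJc => ?_
    have hC : IsCompact (J ×ˢ tsupport ψ) := hJc.prod hψ.hasCompactSupport
    have hCQ : J ×ˢ tsupport ψ ⊆ (Q : Set (ℝ × E)) := prod_mono hJ hψ.tsupport_subset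
    have h1 : IntegrableOn (fun z : ℝ × E =>
        fderiv ℝ (fderiv ℝ ψ) z.2 (u z.1 z.2) (u z.1 z.2) + p z.1 z.2 * Δ ψ z.2)
        (J ×ˢ (univ : Set E)) volume :=
      integrableOn_hessian_add_pressure_mul_of_locallyIntegrableOn hu hu2 hp (hHc.comp continuous_snd)
        (hΔc.comp continuous_snd) hC hCQ (hJc.measurableSet.prod MeasurableSet.univ)
        (fun z hz hzC => hH0 _ fun hx => hzC ⟨(mem_prod.1 hz).1, hx⟩)
        (fun z hz hzC => hΔ0 _ fun hx => hzC ⟨(mem_prod.1 hz).1, hx⟩)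
    have h2 : Integrable (fun z : ℝ × E =>
        fderiv ℝ (fderiv ℝ ψ) z.2 (u z.1 z.2) (u z.1 z.2) + p z.1 z.2 * Δ ψ z.2)
        ((volume.restrict J).prod (volume : Measure E)) := by
      rw [Measure.restrict_prod_eq_prod_univ J]
      exact h1
    exact h2.integral_prod_left
  -- the fundamental lemma of the calculus of variations in `t`
  have hkey : ∀ᵐ t ∂(volume : Measure ℝ), t ∈ Ioo a b → g t = 0 := by
    refine isOpen_Ioo.ae_eq_zero_of_integral_contDiff_smul_eq_zero hloc ?_
    intro η hη hηc hηs
    have hθ : IsSpaceTimeTestOn Q (fun t x => η t * ψ x) := isSpaceTimeTestOn_mul hη hηc hηs hψ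
    have hid := hid _ hθ
    -- the jets of `x ↦ η t ψ x`
    have hH : ∀ t x, fderiv ℝ (fderiv ℝ (fun y => η t * ψ y)) x =
        η t • fderiv ℝ (fderiv ℝ ψ) x := by
      intro t x
      have h1 : fderiv ℝ (fun y => η t * ψ y) = fun y => η t • fderiv ℝ ψ y := by
        funext y
        exact fderiv_const_mul ((hψ.contDiff.differentiable (by simp)).differentiableAt) _
      rw [h1]
      exact fderiv_const_smul
        (((hψ2.fderiv_right (m := 1) (by norm_num)).differentiable (by norm_num)).differentiableAt)
        (η t)
    have hL : ∀ t x, Δ (fun y => η t * ψ y) x = η t * Δ ψ x := by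
      intro t x
      have e : (fun y => η t * ψ y) = η t • ψ := rfl
      rw [e, InnerProductSpace.laplacian_smul _ hψ2.contDiffAt, smul_eq_mul]
    set F : ℝ × E → ℝ := fun z =>
      η z.1 * (fderiv ℝ (fderiv ℝ ψ) z.2 (u z.1 z.2) (u z.1 z.2) + p z.1 z.2 * Δ ψ z.2) with hF
    have hid' : ∫ z in (Q : Set (ℝ × E)), F z = 0 := by
      rw [← hid]
      refine setIntegral_congr_fun Q.isOpen.measurableSet fun z _ => ?_
      simp only [hF, hH, hL, smul_apply, smul_eq_mul]
      ring
    -- `F` is integrable on `ℝ × E` and vanishes off `supp η × supp ψ ⊆ Q`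
    have hC : IsCompact (tsupport η ×ˢ tsupport ψ) := hηc.prod hψ.hasCompactSupport
    have hCQ : tsupport η ×ˢ tsupport ψ ⊆ (Q : Set (ℝ × E)) := prod_mono hηs hψ.tsupport_subset
    have hout : ∀ z : ℝ × E, z ∉ tsupport η ×ˢ tsupport ψ →
        η z.1 = 0 ∨ (fderiv ℝ (fderiv ℝ ψ) z.2 = 0 ∧ Δ ψ z.2 = 0) := by
      intro z hz
      rcases not_and_or.1 (fun h => hz (mem_prod.2 h)) with ht | hx
      · exact Or.inl (image_eq_zero_of_notMem_tsupport ht)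
      · exact Or.inr ⟨hH0 _ hx, hΔ0 _ hx⟩
    have hF0 : ∀ z ∉ tsupport η ×ˢ tsupport ψ, F z = 0 := by
      intro z hz
      rcases hout z hz with h0 | ⟨h1, h2⟩
      · simp [hF, h0]
      · simp [hF, h1, h2]
    have hFi : Integrable F (volume : Measure (ℝ × E)) := by
      have hηc' : Continuous η := hη.continuous
      have h1 : IntegrableOn (fun z : ℝ × E =>
          (η z.1 • fderiv ℝ (fderiv ℝ ψ) z.2) (u z.1 z.2) (u z.1 z.2) +
            p z.1 z.2 * (η z.1 * Δ ψ z.2)) univ volume :=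
        integrableOn_hessian_add_pressure_mul_of_locallyIntegrableOn hu hu2 hp
          ((hηc'.comp continuous_fst).smul (hHc.comp continuous_snd))
          ((hηc'.comp continuous_fst).mul (hΔc.comp continuous_snd)) hC hCQ MeasurableSet.univ
          (fun z _ hzC => by
            rcases hout z hzC with h0 | ⟨h1, -⟩
            · simp [h0]
            · simp [h1])
          (fun z _ hzC => by
            rcases hout z hzC with h0 | ⟨-, h2⟩
            · simp [h0]
            · simp [h2])
      rw [integrableOn_univ] at h1
      refine h1.congr (Eventually.of_forall fun z => ?_)
      simp only [hF, smul_apply, smul_eq_mul]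
      ring
    have hset : ∫ z in (Q : Set (ℝ × E)), F z = ∫ z, F z :=
      setIntegral_eq_integral_of_forall_compl_eq_zero fun z hz => hF0 z fun hz' => hz (hCQ hz')
    have hiter : ∫ z, F z = ∫ t, ∫ x, F (t, x) := by
      rw [Measure.volume_eq_prod]
      exact integral_prod F (by rw [← Measure.volume_eq_prod]; exact hFi)
    have hin : ∀ t, ∫ x, F (t, x) = η t • g t := by
      intro t
      simp only [hF, hg, smul_eq_mul]
      exact integral_const_mul _ _
    calc ∫ t, η t • g t = ∫ t, ∫ x, F (t, x) := by simp_rw [hin]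
      _ = 0 := by rw [← hiter, ← hset]; exact hid'
  rw [ae_restrict_iff' measurableSet_Ioo]
  filter_upwards [hkey] with t ht htI
  exact ht htI

-- nested operator types
set_option maxSynthPendingDepth 3 in
/-- **The slice identity for all test functions at almost every time (bare pressure
identity).** In the situation of `ae_slice_pressure_identity_of_identity`, for a.e. `t ∈ (a, b)`
at which the slices `|u(t)|²` and `p(t)` are locally integrable on `Ω` (and `u(t)` is
a.e.-strongly measurable there), `∫ p(t) Δψ = -∫ D²ψ(u(t), u(t))` for **all** `ψ ∈ C_c^∞(Ω)`
(countably many test functions control all second-order jets,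
`exists_countable_testFunctions_dense_hessian`; verbatim
`IsDistributionalNSSolutionOn.ae_forall_slice_pressure_identity`). [cite: Seregin2014, §6.3 (proof of Prop. 3.10)] -/
theorem ae_forall_slice_pressure_identity_of_identity
    (hu : LocallyIntegrableOn (uncurry u) (Ioo a b ×ˢ (Ω : Set E)) volume)
    (hu2 : LocallyIntegrableOn (fun z => ‖uncurry u z‖ ^ 2) (Ioo a b ×ˢ (Ω : Set E)) volume)
    (hp : LocallyIntegrableOn (uncurry p) (Ioo a b ×ˢ (Ω : Set E)) volume)
    (hid : ∀ θ : ℝ → E → ℝ,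
      IsSpaceTimeTestOn (⟨Ioo a b ×ˢ (Ω : Set E), isOpen_Ioo.prod Ω.isOpen⟩ : Opens (ℝ × E)) θ →
      ∫ z in Ioo a b ×ˢ (Ω : Set E),
        (fderiv ℝ (fderiv ℝ (θ z.1)) z.2 (u z.1 z.2) (u z.1 z.2) + p z.1 z.2 * Δ (θ z.1) z.2) = 0) :
    ∀ᵐ t ∂(volume.restrict (Ioo a b)),
      AEStronglyMeasurable (u t) (volume.restrict (Ω : Set E)) →
      LocallyIntegrableOn (fun x => ‖u t x‖ ^ 2) (Ω : Set E) volume →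
      LocallyIntegrableOn (p t) (Ω : Set E) volume →
      ∀ ψ : E → ℝ, FunctionSpaces.IsTestFunctionOn Ω ψ →
        ∫ x, p t x * Δ ψ x = -∫ x, fderiv ℝ (fderiv ℝ ψ) x (u t x) (u t x) := by
  obtain ⟨K, hKc, hKΩ, hKabs⟩ := exists_compact_exhaustion_absorbing Ω
  have hD := fun m => exists_countable_testFunctions_dense_hessian Ω (hKc m)
  choose D hDc hDT hDd using hD
  have hae : ∀ᵐ t ∂(volume.restrict (Ioo a b)), ∀ m, ∀ φ ∈ D m,
      ∫ x, (fderiv ℝ (fderiv ℝ φ) x (u t x) (u t x) + p t x * Δ φ x) = 0 := by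
    rw [ae_all_iff]
    intro m
    rw [ae_ball_iff (hDc m)]
    intro φ hφ
    exact ae_slice_pressure_identity_of_identity hu hu2 hp hid (hDT m φ hφ).1
  filter_upwards [hae] with t ht hum hu2 hp ψ hψ
  obtain ⟨m, hm⟩ := hKabs _ hψ.tsupport_subset hψ.hasCompactSupport
  obtain ⟨s, hsD, hsH, hsL⟩ := hDd m ψ hψ hm
  have hKm := hKc m
  have hu2K : IntegrableOn (fun x => ‖u t x‖ ^ 2) (K m) volume :=
    hu2.integrableOn_compact_subset (hKΩ m) hKm
  have hpK : IntegrableOn (p t) (K m) volume := hp.integrableOn_compact_subset (hKΩ m) hKm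
  have humK : AEStronglyMeasurable (u t) (volume.restrict (K m)) :=
    hum.mono_measure (Measure.restrict_mono (hKΩ m) le_rfl)
  have hT : ∀ k, FunctionSpaces.IsTestFunctionOn Ω (s k) ∧ tsupport (s k) ⊆ K m := fun k =>
    hDT m _ (hsD k)
  -- jets of test functions: continuity and vanishing off `K m`
  have hHc : ∀ {φ : E → ℝ}, FunctionSpaces.IsTestFunctionOn Ω φ →
      Continuous (fderiv ℝ (fderiv ℝ φ)) := fun hφ =>
    ((contDiff_infty.1 hφ.contDiff 2).fderiv_right (m := 1) (by norm_num)).continuous_fderiv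
      one_ne_zero
  have hΔc : ∀ {φ : E → ℝ}, FunctionSpaces.IsTestFunctionOn Ω φ → Continuous (Δ φ) := fun hφ =>
    FluidPDE.continuous_laplacian (contDiff_infty.1 hφ.contDiff 2)
  have hH0 : ∀ {φ : E → ℝ}, tsupport φ ⊆ K m → ∀ x ∉ K m, fderiv ℝ (fderiv ℝ φ) x = 0 :=
    fun hφ x hx => fderiv_fderiv_eq_zero_of_notMem_tsupport fun h => hx (hφ h)
  have hΔ0 : ∀ {φ : E → ℝ}, tsupport φ ⊆ K m → ∀ x ∉ K m, Δ φ x = 0 :=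
    fun hφ x hx => FluidPDE.laplacian_eq_zero_of_notMem_tsupport fun h => hx (hφ h)
  -- integrability of the two pairings at time `t`
  have hiH : ∀ {φ : E → ℝ}, FunctionSpaces.IsTestFunctionOn Ω φ → tsupport φ ⊆ K m →
      Integrable (fun x => fderiv ℝ (fderiv ℝ φ) x (u t x) (u t x)) (volume : Measure E) :=
    fun hφ hφK =>
      integrable_bilin_apply_self_of_eq_zero_off_compact hKm (hHc hφ) (hH0 hφK) humK hu2K
  have hiP : ∀ {φ : E → ℝ}, FunctionSpaces.IsTestFunctionOn Ω φ → tsupport φ ⊆ K m →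
      Integrable (fun x => p t x * Δ φ x) (volume : Measure E) := fun hφ hφK =>
    (integrable_mul_of_eq_zero_off_compact hKm (hΔc hφ) (hΔ0 hφK) hpK).congr
      (Eventually.of_forall fun x => mul_comm _ _)
  -- the identity along the sequence, in split form
  have hk : ∀ k, ∫ x, p t x * Δ (s k) x = -∫ x, fderiv ℝ (fderiv ℝ (s k)) x (u t x) (u t x) := by
    intro k
    have h0 := ht m (s k) (hsD k)
    rw [integral_add (hiH (hT k).1 (hT k).2) (hiP (hT k).1 (hT k).2)] at h0
    linarith
  -- pass to the limit in both pairings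
  have e : ∀ φ : E → ℝ, (∫ x, Δ φ x * p t x) = ∫ x, p t x * Δ φ x := fun φ =>
    integral_congr_ae (Eventually.of_forall fun x => mul_comm _ _)
  have hlimP : Tendsto (fun k => ∫ x, p t x * Δ (s k) x) atTop (𝓝 (∫ x, p t x * Δ ψ x)) := by
    have h := tendsto_integral_mul_of_tendstoUniformly hKm hpK (fun k => hΔc (hT k).1) (hΔc hψ)
      (fun k => hΔ0 (hT k).2) hsL
    rw [← e ψ]
    exact h.congr fun k => e (s k)
  have hlimH : Tendsto (fun k => -∫ x, fderiv ℝ (fderiv ℝ (s k)) x (u t x) (u t x)) atTop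
      (𝓝 (-∫ x, fderiv ℝ (fderiv ℝ ψ) x (u t x) (u t x))) :=
    (tendsto_integral_bilin_apply_self_of_tendstoUniformly hKm humK hu2K (fun k => hHc (hT k).1)
      (hHc hψ) (fun k => hH0 (hT k).2) hsH).neg
  exact tendsto_nhds_unique hlimP (hlimH.congr fun k => (hk k).symm)

end SliceIdentity

end Literature.Analysis.FluidPDE

end
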